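import Literature.AlgebraicGeometry.Frobenioids.ArchimedeanUnitCircle
import Literature.AlgebraicGeometry.Frobenioids.ArchimedeanAngularIstr
import HarnessLib

/-!
# Frobenioids II, Theorem 3.6 (v), "`O^×(A) ≅ S¹`" — PROVED for the angular Frobenioid `A`

Mochizuki, *The geometry of Frobenioids II*, Kyushu J. Math. **62** (2008) 401–460, §3, Theorem 3.6 (v),
author's kurims text p. 37 [cite: MochizukiFrdII2008, Thm 3.6 (v) p.37] (`F = A`, `Λ = ℤ`): "[`O^×(A)`]
has infinitely many torsion elements [and is in fact isomorphic to `S¹`] if and only if `Λ = ℤ` and `A`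
is complex isotropic." DISCHARGE of the bracket `ArchFrd.Thm36v_isoCircle` at the angular Frobenioid
`A π ⊆ C π` of Example 3.3 (iii) (`AngularFrobenioidsRelative.lean`, seat abc-iut-L1-t6; structure
`A.toElem π`, base comparison `π ⋙ D0.toArchBase`), transported from the archimedean Frobenioid `C`
(`ArchimedeanUnitCircle.lean`): the unit-scalar automorphisms `((id, 1, c), id)`, `|c| = 1`, are isometries,
hence automorphisms of `A`, and an element of `O^×` of `A` is one of `O^×` of `C`.
No statement of the paper is strengthened.
-/

namespace Literature.AlgebraicGeometry.Frobenioids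

open CategoryTheory

universe v u

namespace ArchFrd

variable {D : Type u} [Category.{v} D] (π : D ⥤ D0)

/-- A unit-scalar endomorphism `(id, 1, c)`, `|c| = 1`, of `C₀` is an isometry.
[cite: MochizukiFrdII2008, Thm 3.6 (v) p.37] -/
theorem C0.isIsometry_unitScalarEnd (X : C0) (hX : X.IsNaivelyIsotropic) (hc : X.IsComplexObj)
    (c : ℂˣ) (hn : ‖(c : ℂ)‖ = 1) :
    PreFrobenioid.IsIsometry C0.toElem (C0.unitScalarEnd X hX hc c hn) := by
  rw [A0.isIsometry_iff_norm_mul_tip_pow]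
  change ‖(c : ℂ)‖ * X.tip ^ ((1 : ℕ+) : ℕ) = X.tip
  rw [hn, one_mul, PNat.one_coe, pow_one]

/-- The automorphism `((id, 1, c), id)` of `C` is an automorphism of `A` (both directions are isometries).
[cite: MochizukiFrdII2008, Thm 3.6 (v) p.37] -/
noncomputable def A.unitAutOver (X : A π) (hX : X.obj.fst.IsNaivelyIsotropic)
    (hc : X.obj.fst.IsComplexObj) (c : ℂˣ) (hn : ‖(c : ℂ)‖ = 1) : X ≅ X :=
  CategoryTheory.isoMk (ArchFrd.unitAutOver π X.obj hX hc c hn)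
    (by
      change pull Φ₀ X.obj.iso.inv (PreFrobenioid.Div C0.toElem (C0.unitScalarEnd X.obj.fst hX hc c hn)) = 1
      rw [C0.isIsometry_unitScalarEnd]; exact map_one _)
    (by
      have hn' : ‖((c⁻¹ : ℂˣ) : ℂ)‖ = 1 := by rw [Units.val_inv_eq_inv_val, norm_inv, hn, inv_one]
      change pull Φ₀ X.obj.iso.inv
        (PreFrobenioid.Div C0.toElem (C0.unitScalarEnd X.obj.fst hX hc c⁻¹ hn')) = 1
      rw [C0.isIsometry_unitScalarEnd]; exact map_one _)

/-- `A.unitAutOver c ∈ O^×(X)` for the structure `A.toElem`. [cite: MochizukiFrdII2008, Thm 3.6 (v) p.37] -/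
theorem A.unitAutOver_mem (X : A π) (hX : X.obj.fst.IsNaivelyIsotropic) (hc : X.obj.fst.IsComplexObj)
    (c : ℂˣ) (hn : ‖(c : ℂ)‖ = 1) :
    A.unitAutOver π X hX hc c hn ∈ PreFrobenioid.unitsSubgroup (A.toElem π) X :=
  ⟨rfl, rfl⟩

/-- The homomorphism `S¹ → Aut_A(X)`, `z ↦ ((id, 1, z), id)`. [cite: MochizukiFrdII2008, Thm 3.6 (v) p.37] -/
noncomputable def A.circleToAut (X : A π) (hX : X.obj.fst.IsNaivelyIsotropic)
    (hc : X.obj.fst.IsComplexObj) : Circle →* Aut X where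
  toFun z := A.unitAutOver π X hX hc (Circle.toUnits z) (norm_coe_circle_toUnits z)
  map_one' := by
    apply Iso.ext
    apply WideSubcategory.hom_ext
    exact congrArg Iso.hom (ArchFrd.circleToAut π X.obj hX hc).map_one
  map_mul' z w := by
    apply Iso.ext
    apply WideSubcategory.hom_ext
    exact congrArg Iso.hom ((ArchFrd.circleToAut π X.obj hX hc).map_mul z w)

/-- An element of `O^×` of `A` gives an element of `O^×` of `C` (same conditions).
[cite: MochizukiFrdII2008, Thm 3.6 (v) p.37] -/
theorem A.mapIso_mem_unitsSubgroup (X : A π) (u : Aut X)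
    (hu : u ∈ PreFrobenioid.unitsSubgroup (A.toElem π) X) :
    (A.ι π).mapIso u ∈ PreFrobenioid.unitsSubgroup (C.toElem π) X.obj :=
  ⟨hu.1, hu.2⟩

/-- **Theorem 3.6 (v), "`O^×(A) ≅ S¹` for `Λ = ℤ` and `A` complex isotropic", for the angular Frobenioid
`A`** (PROVED, over any base). [cite: MochizukiFrdII2008, Thm 3.6 (v) p.37] -/
theorem thm36v_isoCircle_A : Thm36v_isoCircle (π ⋙ D0.toArchBase) (A.toElem π) MonoidType.Z := by
  intro _ X hXc hXi
  have hX : X.obj.fst.IsNaivelyIsotropic := A.isNaivelyIsotropic_of_isIsotropic π X hXi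
  have hπ : (π.obj X.obj.snd).IsComplex := (D0.isComplex_toArchBase_iff _).mp hXc
  have hc : X.obj.fst.IsComplexObj := D0.isComplex_of_hom X.obj.iso.hom hπ
  let ψ := (A.circleToAut π X hX hc).codRestrict (PreFrobenioid.unitsSubgroup (A.toElem π) X)
    (fun z => A.unitAutOver_mem π X hX hc _ _)
  refine ⟨(MulEquiv.ofBijective ψ ⟨?_, ?_⟩).symm⟩
  · intro z w h
    have h' := congrArg (fun v : PreFrobenioid.unitsSubgroup (A.toElem π) X =>
      C0.scalar (v : Aut X).hom.hom.fst) h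
    change Circle.toUnits z = Circle.toUnits w at h'
    exact Circle.ext (by
      have := congrArg (fun c : ℂˣ => (c : ℂ)) h'
      simpa [Circle.toUnits_apply] using this)
  · rintro ⟨u, hu⟩
    have huC := A.mapIso_mem_unitsSubgroup π X u hu
    have hn := norm_scalar_eq_one_of_mem_unitsSubgroup π X.obj hX ((A.ι π).mapIso u) huC
    refine ⟨⟨((C0.scalar u.hom.hom.fst : ℂˣ) : ℂ), mem_sphere_zero_iff_norm.mpr hn⟩, ?_⟩
    apply Subtype.ext
    change A.unitAutOver π X hX hc _ _ = u
    apply Iso.ext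
    apply WideSubcategory.hom_ext
    have e := congrArg Iso.hom (eq_unitAutOver_of_mem π X.obj hX hc ((A.ι π).mapIso u) huC)
    refine Eq.trans ?_ e.symm
    change (ArchFrd.unitAutOver π X.obj hX hc _ _).hom = (ArchFrd.unitAutOver π X.obj hX hc _ _).hom
    congr 2
    exact Units.ext (by rw [Circle.toUnits_apply, Units.val_mk0]; rfl)

end ArchFrd

end Literature.AlgebraicGeometry.Frobenioids
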